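import Mathlib
import Summits.ValiantsHypothesis.ValiantsHypothesis.Theorems.FifoMatchingNFPolytopeQueueGridGadgetPositions
import Summits.ValiantsHypothesis.ValiantsHypothesis.Theorems.FifoMatchingNNMonotoneHardQueue
import Summits.ValiantsHypothesis.ValiantsHypothesis.Theorems.FifoMatchingNNLinearDegreeCofactorHardWordPrefixCounts
import HarnessLib

/-!
# Route `FifoMatching`, item `NFPolytopeQuasiPolyXC` (K1, stmt-26254), line `queue_grid_face`, INPUT (A):
# the design word is a balanced ballot word (prefix counts in closed form)

For every bit matrix `X` the layout-B word `word X` has exactly `cU X x` pushes strictly before the symbolic position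
`x` (`card_openers_lt`, by induction along `predQ`), hence `half r d` pushes and `half r d` pops (`card_openerSet_word`,
`balanced_word`), and every prefix has at least as many pushes as pops (`toNat_le_two_mul_cU`), so it is a ballot word
(`isBallot_word`) and its FIFO pairing `design X` is a nest-free perfect matching of `Fin (2 · half r d)`
(`design_mem_nestFreeMatchings`, from `Literature…fifo_mem_nestFreeMatchings`) whose openers are the pushes
(`lt_design_iff`).  Honest framing: bookkeeping for input (A); nothing here bears on K1 or VP ≠ VNP.
-/

noncomputable section

-- Sub = Summit single-conjunct layout: the duplicated namespace component is mandated by the tree.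
set_option linter.dupNamespace false

namespace Summit.ValiantsHypothesis.ValiantsHypothesis.Theorems.FifoMatching.NFPolytopeQuasiPolyXC.QueueGridFace

open Finset Literature.Computability.AlgebraicComplexity
open Summit.ValiantsHypothesis.ValiantsHypothesis.Theorems.FifoMatching.NNMonotoneHard
open Summit.ValiantsHypothesis.ValiantsHypothesis.Theorems.FifoMatching.NNLinearDegreeCofactorHard.InflateWord

namespace QPos

variable {r d : ℕ} (X : Fin r × Fin r → Bool)

/-- Only `pre 0` sits at position `0`, and no push precedes it. -/
theorem cU_eq_zero_of_toNat (x : QPos r d) (hx : x.toNat = 0) : cU X x = 0 := by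
  have h0 : (pre ⟨0, Nat.succ_pos _⟩ : QPos r d).toNat = 0 := rfl
  rw [toNat_injective (hx.trans h0.symm)]; rfl

/-- `uw` steps: the pushes among the first `t+1` slots are those among the first `t` plus the letter of slot `t`. -/
theorem uw_succ (b : Bool) (t : ℕ) (ht : t < 4) : uw b (t + 1) = uw b t + (decide (t < 2) == b).toNat := by
  unfold uw
  interval_cases t <;> cases b <;> simp

/-- a full window contributes two pushes: `uw b 3 + [slot 3 pushes] = 2` -/
theorem uw_add_isU_three (s i : Fin r) :
    uw (X (s, i)) ((3 : Fin 4) : ℕ) + (isU X (slot s i 3 : QPos r d)).toNat = 2 := by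
  cases h : X (s, i) <;> simp [uw, isU, h]

/-- a window starts with no push counted: `uw b 0 = 0` -/
@[simp] theorem uw_zero (b : Bool) : uw b 0 = 0 := by cases b <;> simp [uw]

/-- **Closed form, one step**: the count before `x` is the count before its predecessor plus the predecessor's letter. -/
theorem cU_predQ (x : QPos r d) (hx : x.toNat ≠ 0) : cU X x = cU X (predQ x) + (isU X (predQ x)).toNat := by
  cases x with
  | pre j => simp only [toNat] at hx; simp only [predQ_pre, cU, isU, Bool.toNat_true]; omega
  | frU s =>
    by_cases h : s.val = 0
    · rw [predQ_frU_zero s h]; simp only [cU, isU, Bool.toNat_true, h]; ring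
    · rw [predQ_frU_ne s h]; simp only [cU, isU, Bool.toNat_false, Nat.add_zero]
      have e : s.val - 1 + 1 = s.val := Nat.sub_add_cancel (Nat.pos_of_ne_zero h)
      rw [e, Nat.mul_add_one]; ring
  | slot s i t =>
    by_cases ht : t.val = 0
    · by_cases hi : i.val = 0
      · rw [predQ_slot_zero_zero s i t ht hi]; simp only [cU, isU, Bool.toNat_true, hi, ht, Nat.mul_zero, uw_zero]
      · rw [predQ_slot_zero_ne s i t ht hi]
        have := uw_add_isU_three (d := d) X s ⟨i.val - 1, by have := i.isLt; omega⟩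
        simp only [cU, ht, uw_zero, Nat.add_zero]
        omega
    · rw [predQ_slot_ne s i t ht]; simp only [cU, isU]
      have e : t.val - 1 + 1 = t.val := Nat.sub_add_cancel (Nat.pos_of_ne_zero ht)
      have := uw_succ (X (s, i)) (t.val - 1) (by have := t.isLt; omega)
      rw [e] at this
      rw [this]; omega
  | frD s =>
    have hr := s.isLt
    rw [predQ_frD]
    have := uw_add_isU_three (d := d) X s ⟨r - 1, by omega⟩
    simp only [cU]
    omega
  | post j =>
    by_cases hj : j.val = 0
    · by_cases hr : 0 < r
      · rw [predQ_post_zero j hj hr]; simp only [cU, isU, Bool.toNat_false, Nat.add_zero]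
        have e : r - 1 + 1 = r := Nat.sub_add_cancel hr
        rw [e]; ring
      · rw [predQ_post_zero_zero j hj hr]; simp only [cU, isU, Bool.toNat_true]
        have hr0 : r = 0 := by omega
        subst hr0; norm_num
    · rw [predQ_post_ne j hj]; simp only [cU, isU, Bool.toNat_false, Nat.add_zero]
  | pad j =>
    by_cases hj : j.val = 0
    · rw [predQ_pad_zero j hj]; simp only [cU, isU, Bool.toNat_false, Nat.add_zero, hj]; omega
    · rw [predQ_pad_ne j hj]; simp only [cU, isU]
      rcases Bool.eq_false_or_eq_true (decide ((j.val - 1) % 2 = 0)) with h | h <;>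
        · rw [h]; simp only [Bool.toNat_true, Bool.toNat_false, decide_eq_true_eq, decide_eq_false_iff_not] at h ⊢; omega

/-- **Prefix counts of the design word**: exactly `cU X x` pushes precede the symbolic position `x`. -/
theorem card_openers_lt (x : QPos r d) :
    ((openerSet (word d X)).filter fun i => i.val < x.toNat).card = cU X x := by
  suffices h : ∀ (n : ℕ) (x : QPos r d), x.toNat = n →
      ((openerSet (word d X)).filter fun i => i.val < n).card = cU X x from h _ x rfl
  intro n
  induction n with
  | zero => intro x hx; rw [card_filter_lt_zero, cU_eq_zero_of_toNat X x hx]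
  | succ n ih =>
    intro x hx
    have hx0 : x.toNat ≠ 0 := by omega
    have hy : (predQ x).toNat = n := by have := toNat_predQ x hx0; omega
    rw [card_filter_lt_succ_nat, ih _ hy, cU_predQ X x hx0, dif_pos (hy ▸ (predQ x).toNat_lt)]
    congr 1
    have e : (⟨n, hy ▸ (predQ x).toNat_lt⟩ : Fin (2 * half r d)) = (predQ x).toFin := Fin.ext hy.symm
    simp only [e, mem_openerSet, word_toFin]
    cases isU X (predQ x) <;> simp

/-- **The design word has `half r d` pushes.** (Count up to the last letter — `pad (2d-1)` or, without padding,
`post 2r` — which is a pop preceded by `half r d` pushes.) -/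
theorem card_openerSet_word : (openerSet (word d X)).card = half r d := by
  have h2 := two_mul_eq r
  -- the last symbolic position, its position and its counts
  obtain ⟨z, hz, hc, hu⟩ : ∃ z : QPos r d, z.toNat + 1 = 2 * half r d ∧ cU X z = half r d ∧ isU X z = false := by
    by_cases h : 0 < d
    · refine ⟨pad ⟨2 * d - 1, by omega⟩, ?_, ?_, ?_⟩
      · simp only [toNat, half]; omega
      · simp only [cU, half]; omega
      · simp only [isU, decide_eq_false_iff_not]; omega
    · refine ⟨post ⟨2 * r, by omega⟩, ?_, ?_, rfl⟩
      · simp only [toNat, half]; omega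
      · simp only [cU, half]; omega
  have hlt : z.toNat < 2 * half r d := z.toNat_lt
  have h1 : ((openerSet (word d X)).filter fun i => i.val < z.toNat + 1).card = (openerSet (word d X)).card :=
    card_filter_lt_of_le _ (by rw [hz])
  rw [← h1, card_filter_lt_succ_nat, card_openers_lt, hc, dif_pos hlt]
  have e : (⟨z.toNat, hlt⟩ : Fin (2 * half r d)) = z.toFin := rfl
  simp only [e, mem_openerSet, word_toFin, hu]
  simp

/-- **The design word is balanced**: as many pops as pushes. -/
theorem balanced_word : (closerSet (word d X)).card = (openerSet (word d X)).card := by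
  rw [closerSet_eq_compl, card_compl, card_openerSet_word, Fintype.card_fin]
  simp only [half]; omega

/-- **Every prefix has at least as many pushes as pops**: position `≤ 2 ·` pushes before it. -/
theorem toNat_le_two_mul_cU (x : QPos r d) : x.toNat ≤ 2 * cU X x := by
  have hsq := sq_eq r
  have h2 := two_mul_eq r
  cases x with
  | pre j => simp only [toNat, cU]; omega
  | frU s =>
    simp only [toNat, cU]
    have e : s.val * (4 * r + 2) = 2 * ((2 * r + 1) * s.val) := by ring
    rw [e, Nat.mul_add_one]; omega
  | slot s i t =>
    have := s.isLt; have := t.isLt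
    simp only [toNat, cU]
    have e : s.val * (4 * r + 2) = 2 * ((2 * r + 1) * s.val) := by ring
    rw [e, Nat.mul_add_one]; omega
  | frD s =>
    simp only [toNat, cU]
    have e : s.val * (4 * r + 2) = 2 * ((2 * r + 1) * s.val) := by ring
    rw [e, Nat.mul_add_one]; omega
  | post j =>
    have := j.isLt
    simp only [toNat, cU]
    generalize (2 * r + 1) * (2 * r + 1) = Q at hsq h2 ⊢
    omega
  | pad j => simp only [toNat, cU]; omega

/-- Prefix form of the ballot condition for the design word, at every `t : ℕ`. -/
theorem card_closers_lt_le (t : ℕ) :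
    ((closerSet (word d X)).filter fun i => i.val < t).card
      ≤ ((openerSet (word d X)).filter fun i => i.val < t).card := by
  by_cases ht : t ≤ 2 * half r d
  · have hadd := card_openers_lt_add (word d X) t ht
    suffices t ≤ 2 * ((openerSet (word d X)).filter fun i => i.val < t).card by omega
    rcases Nat.lt_or_ge t (2 * half r d) with hlt | hge
    · obtain ⟨x, hx⟩ := exists_toFin_eq (⟨t, hlt⟩ : Fin (2 * half r d))
      have hxt : x.toNat = t := by simpa using congrArg Fin.val hx
      rw [← hxt, card_openers_lt]
      exact toNat_le_two_mul_cU X x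
    · have hteq : t = 2 * half r d := le_antisymm ht hge
      rw [hteq, card_filter_lt_of_le _ le_rfl, card_openerSet_word]
  · rw [not_le] at ht
    rw [card_filter_lt_of_le _ ht.le, card_filter_lt_of_le _ ht.le, balanced_word]

/-- **The design word is a ballot word.** -/
theorem isBallot_word : IsBallot (word d X) (balanced_word (d := d) X) :=
  isBallot_of_prefix_le (balanced_word X) (card_closers_lt_le X)

end QPos

variable {r d : ℕ}

/-- **The design is the FIFO pairing of the (balanced) design word.** -/
theorem design_eq_fifo (X : Fin r × Fin r → Bool) : design d X = fifo (word d X) (QPos.balanced_word X) :=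
  funext fun _ => dif_pos (QPos.balanced_word X)

/-- **Designs are nest-free perfect matchings** (`Literature…fifo_mem_nestFreeMatchings`). -/
theorem design_mem_nestFreeMatchings (X : Fin r × Fin r → Bool) :
    design d X ∈ nestFreeMatchings (2 * half r d) := by
  rw [design_eq_fifo]; exact fifo_mem_nestFreeMatchings (QPos.isBallot_word X)

/-- The openers of a design are the pushes of its word. -/
theorem lt_design_iff (X : Fin r × Fin r → Bool) (p : Fin (2 * half r d)) : p < design d X p ↔ word d X p = true := by
  rw [design_eq_fifo]; exact lt_fifo_iff (QPos.isBallot_word X) p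

/-- The openers of a design, at symbolic positions. -/
theorem toFin_lt_design_iff (X : Fin r × Fin r → Bool) (x : QPos r d) :
    x.toFin < design d X x.toFin ↔ QPos.isU X x = true := by
  rw [lt_design_iff, word_toFin]

end Summit.ValiantsHypothesis.ValiantsHypothesis.Theorems.FifoMatching.NFPolytopeQuasiPolyXC.QueueGridFace

end
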